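import Literature.NumberTheory.ComplexMultiplication.TypeRankCharacterSums
import Literature.AlgebraicGeometry.Pohlmann1968.CMTypeRankCharactersNumberField
import HarnessLib

/-!
# Dodson's constant weight criterion (Dodson 1984, §3.1.1): the rank of a CM type of `G = ⟨ρ⟩ × G₀` is
# `r + 1` — or `r` when the weight is `n/2` — with `r` the rank of the `G₀`-translates of its weight vector

B. Dodson, *The structure of Galois groups of CM-fields*, Trans. AMS **283** (1984) [Dodson1984], §3.1.1 (held text
`paper:doi-10-2307-1999987`, pp. 11–12):

> "The following Theorem will be referred to as the "constant weight criterion" for degeneracy.  THEOREM. Suppose the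
> CM-field `K` has an imaginary quadratic subfield, and let `G₀ = Gal(K₀ᶜ/ℚ)` […]. Then `G` as `Gal(Kᶜ/ℚ)` has the
> trivial ρ-structure with `v = 1` on `⟨ρ⟩ × G₀`.  Let `Φ = Φᶠ`, `f ∈ (ℤ₂)ⁿ`, be a CM-type on `K` and let `r` be the
> rank of the `ℤ`-span of the orbit `G₀*(f)`, regarded as a subset of `ℤⁿ`.  Then `t(Φ) = r + 1`, unless the weight
> of `f` is `n/2`, in which case `t(Φ) = r` may also occur."

(Proof, loc. cit., p. 12: "the `G`-orbit of `f` is `G₀*(f) ∪ G₀*(ρf)`"; with `v₁, …, v_r ∈ G₀*(f)` spanning `G₀*(f)`,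
"`t(Φ)` is the rank of the `ℤ`-module spanned by `W = {(v, ρv) ∈ ℤ₂²ⁿ | v ∈ G*(f)}`", a lemma on vectors of constant
weight shows that "`(v₁, ρv₁), …, (v_r, ρv_r), (ρ, ρ)` is a spanning set for `W`", and "the rank of `Φ = Φᶠ` can be
`r` if and only if `(ρ, ρ)` belongs to the `ℤ`-span of the `(v, ρv)`, in which case … `2w = n`".)  Here the same
count is obtained through characters (Kubota's Lemma 2, already in the tree), which is shorter in Lean than the
row bookkeeping.

This file proves the criterion for an ABELIAN CM field `K ⊇ k` (`k` imaginary quadratic, `K₀` its maximal real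
subfield, `K = K₀k`), in the abstract setting of the tree's `CMTypeRank.lean` / `CMTypeRankCharacters.lean`: `G` a
finite commutative group acting on itself (Kubota: `Hom(K, ℂ)` is a `Gal(K/ℚ)`-torsor), `ρ ∈ G` the complex
conjugation, `G₀ ≤ G` a subgroup with `G = G₀ ⊔ ρG₀`, `ρ ∉ G₀` (`G₀ = Gal(K/k) ≅ Gal(K₀/ℚ)`), `Φ` a CM type for `ρ`
(`IsCMTypeWith ρ Φ`).  Dodson's weight vector `f ∈ (ℤ₂)ⁿ` is the finite set `f = {s ∈ G₀ : s ∉ Φ}` (so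
`Φ = (G₀ ∖ f) ⊔ ρf`; given as a `Finset ↥G₀` with its membership criterion `hf`), its weight is `|f|`, `n = |G₀|`, and
his `r` — "the rank of the `ℤ`-span of the orbit `G₀*(f)`" — is the Kubota–Dodson rank `typeRank G₀ f` of `f ⊆ G₀`
under translation by `G₀`.  PROVED:

* `sum_oddChar_eq_sub` — for an odd character `χ` (`χ(ρ) = −1`): `Σ_{x∈Φ} χ(x) = Σ_{s∈G₀} χ(s) − 2 Σ_{s∈f} χ(s)`
  (the character form of "`f − ½(1, …, 1)`");
* **`typeRank_add_eq_typeRank_weight_add`** — the exact relation `t(Φ) + [2|f| = n] = r + 1 + [|f| = 0]`, from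
  Kubota's defect formula (`IsCMTypeWith.typeRank_add_ncard_oddCharacters_vanishing`), the bijection "restriction to
  `G₀`" from the odd characters of `G` onto the characters of `G₀`, and `typeRank_eq_ncard_sum_ne_zero` on `G₀`;
* **`typeRank_eq_typeRank_weight_add_one`** — `t(Φ) = r + 1` when `|f| ∉ {0, n/2}` (Dodson's generic case);
  **`typeRank_eq_typeRank_weight`** — `t(Φ) = r` when `2|f| = n` (for abelian `K` the "may also occur" is forced);
  `typeRank_eq_two_of_weight_zero` — `t(Φ) = 2` for the type `Φ ⊇ G₀` induced from `k` (`|f| = 0`, `r = 0`: the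
  weight tacitly excluded by the printed formula).

The block type of §3.2.1 (`DegenerateCMTypesCompositeDimension(Rank).lean`: `G₀ = ⟨σ⟩` cyclic of order `n = kl`,
`f` an interval of length `l`, `r = n − l + 1`, `t = n − l + 2`) is the motivating instance.  NOT here: Dodson's
general (non-Galois `K₀`, `G₀ ⊆ Sₙ` transitive) setting, which needs the imprimitive `ρ`-structure `(ℤ₂)ⁿ ⋊ G₀` of
§1.1 as an action on `E₀ × {±}`.  Theorems only; no definition, no named fact.

## References

* [Dodson1984] B. Dodson, Trans. AMS 283 (1984), §3.1.1 Theorem (constant weight criterion), pp. 11–12; §3.1.0.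
* [Kubota1965] T. Kubota, Trans. AMS 118 (1965), §4 Lemma 2.
-/

set_option autoImplicit false

noncomputable section

open scoped BigOperators

namespace Literature.NumberTheory.ComplexMultiplication

open Literature.AlgebraicGeometry.Pohlmann1968 (two_mul_ncard_oddCharacters_eq_card)

namespace Dodson1984

/-! ### Dodson's constant weight criterion for `G = G₀ ⊔ ρG₀` -/

section ConstantWeight

open AddChar

variable {G : Type*} [CommGroup G] [Fintype G] (G₀ : Subgroup G) {ρ : G} {Φ : Finset G}

omit [Fintype G] in
/-- `G = G₀ ⊔ ρG₀`: `(s ↦ s) ⊔ (s ↦ ρs) : G₀ ⊕ G₀ → G` is a bijection when `ρ ∉ G₀`, `ρ² = 1` and every `g` lies in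
`G₀` or in `ρG₀`. [folklore] -/
private theorem bijective_sumElim (hρ : ρ ∉ G₀) (hG : ∀ g : G, g ∈ G₀ ∨ ρ * g ∈ G₀) (hρ2 : ρ * ρ = 1) :
    Function.Bijective (Sum.elim (fun s : ↥G₀ => (s : G)) (fun s : ↥G₀ => ρ * (s : G))) := by
  refine ⟨?_, fun g => ?_⟩
  · rintro (s | s) (t | t) hst
    · exact congrArg Sum.inl (Subtype.ext (by simpa using hst))
    · simp only [Sum.elim_inl, Sum.elim_inr] at hst
      have hρ' : ρ = (s : G) * (t : G)⁻¹ := by rw [hst, mul_inv_cancel_right]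
      exact absurd (hρ' ▸ G₀.mul_mem s.2 (G₀.inv_mem t.2)) hρ
    · simp only [Sum.elim_inl, Sum.elim_inr] at hst
      have hρ' : ρ = (t : G) * (s : G)⁻¹ := by rw [← hst, mul_inv_cancel_right]
      exact absurd (hρ' ▸ G₀.mul_mem t.2 (G₀.inv_mem s.2)) hρ
    · simp only [Sum.elim_inr] at hst
      exact congrArg Sum.inr (Subtype.ext (mul_left_cancel hst))
  · rcases hG g with hg | hg
    · exact ⟨Sum.inl ⟨g, hg⟩, rfl⟩
    · exact ⟨Sum.inr ⟨ρ * g, hg⟩, by simp only [Sum.elim_inr, ← mul_assoc, hρ2, one_mul]⟩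

/-- `Σ_{x∈G} F(x) = Σ_{s∈G₀} F(s) + Σ_{s∈G₀} F(ρs)`. [folklore] -/
private theorem sum_eq_sum_add_sum [Fintype ↥G₀] (hρ : ρ ∉ G₀) (hG : ∀ g : G, g ∈ G₀ ∨ ρ * g ∈ G₀)
    (hρ2 : ρ * ρ = 1) (F : G → ℂ) : ∑ x, F x = ∑ s : ↥G₀, F s + ∑ s : ↥G₀, F (ρ * s) := by
  rw [← Fintype.sum_equiv (Equiv.ofBijective _ (bijective_sumElim G₀ hρ hG hρ2))
    (fun x => F (Sum.elim (fun s : ↥G₀ => (s : G)) (fun s : ↥G₀ => ρ * (s : G)) x)) F (fun _ => rfl),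
    Fintype.sum_sum_type]
  simp only [Sum.elim_inl, Sum.elim_inr]

/-- `|G| = 2|G₀|`. [folklore] -/
private theorem card_eq_two_mul [Fintype ↥G₀] (hρ : ρ ∉ G₀) (hG : ∀ g : G, g ∈ G₀ ∨ ρ * g ∈ G₀)
    (hρ2 : ρ * ρ = 1) : Fintype.card G = 2 * Fintype.card ↥G₀ := by
  rw [← Fintype.card_congr (Equiv.ofBijective _ (bijective_sumElim G₀ hρ hG hρ2)), Fintype.card_sum]
  ring

/-- There are `|G₀|` odd characters (`χ(ρ) = −1`) of `G = G₀ ⊔ ρG₀`. [cite: Kubota1965, §4 Lemma 2 (proof: "`ψ₁, …, ψ_m`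
all characters of `G` which take `−1` at `ρ`", `|G| = 2m`)] -/
private theorem ncard_oddChar_eq_card [Fintype ↥G₀] (hρ : ρ ∉ G₀) (hG : ∀ g : G, g ∈ G₀ ∨ ρ * g ∈ G₀)
    (hρ2 : ρ * ρ = 1) :
    {χ : AddChar (Additive G) ℂ | χ (Additive.ofMul ρ) = -1}.ncard = Fintype.card ↥G₀ := by
  have hρ1 : ρ ≠ 1 := fun h1 => hρ (h1 ▸ G₀.one_mem)
  have := two_mul_ncard_oddCharacters_eq_card hρ1 hρ2
  rw [card_eq_two_mul G₀ hρ hG hρ2] at this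
  omega

/-- **The character sums of Dodson's type `Φ = Φᶠ`.**  Let `Φ` be a CM type of `G = G₀ ⊔ ρG₀` for `ρ` and
`f = {s ∈ G₀ : s ∉ Φ}` its weight vector (so `Φ = (G₀ ∖ f) ⊔ ρf`, Dodson's vectors `(v, ρv)`).  For every ODD
character `χ` of `G`: `Σ_{x∈Φ} χ(x) = Σ_{s∈G₀} χ(s) − 2·Σ_{s∈f} χ(s)` (`χ(ρs) = −χ(s)`).
[cite: Dodson1984, §3.1.1 Theorem (proof, p. 12: "`W = {(v, ρv)}`")] [cite: Kubota1965, §4 Lemma 2 (proof)] -/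
theorem sum_oddChar_eq_sub [Fintype ↥G₀] (h : IsCMTypeWith ρ (Φ : Set G)) (hρ : ρ ∉ G₀)
    (hG : ∀ g : G, g ∈ G₀ ∨ ρ * g ∈ G₀) (f : Finset ↥G₀) (hf : ∀ s : ↥G₀, s ∈ f ↔ (s : G) ∉ Φ)
    (χ : AddChar (Additive G) ℂ) (hχ : χ (Additive.ofMul ρ) = -1) :
    ∑ x ∈ Φ, χ (Additive.ofMul x) =
      ∑ s : ↥G₀, χ (Additive.ofMul (s : G)) - 2 * ∑ s ∈ f, χ (Additive.ofMul (s : G)) := by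
  classical
  have hρ2 : ρ * ρ = 1 := by
    have := h.invol (1 : G)
    simpa [smul_eq_mul] using this
  have hmem : ∀ x : G, ρ * x ∈ Φ ↔ x ∉ Φ := fun x => by
    have := h.rho_smul_mem_iff x
    simpa [smul_eq_mul] using this
  have h1 : ∑ x ∈ Φ, χ (Additive.ofMul x) = ∑ x, if x ∈ Φ then χ (Additive.ofMul x) else 0 := by
    rw [Finset.sum_ite_mem, Finset.univ_inter]
  rw [h1, sum_eq_sum_add_sum G₀ hρ hG hρ2]
  have h2 : ∀ s : ↥G₀, (if ρ * (s : G) ∈ Φ then χ (Additive.ofMul (ρ * (s : G))) else 0) =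
      if s ∈ f then -χ (Additive.ofMul (s : G)) else 0 := by
    intro s
    by_cases hs : s ∈ f
    · rw [if_pos hs, if_pos ((hmem s).2 ((hf s).1 hs)), ofMul_mul, map_add_eq_mul, hχ]; ring
    · rw [if_neg hs, if_neg fun h' => hs ((hf s).2 ((hmem s).1 h'))]
  have h3 : ∀ s : ↥G₀, (if (s : G) ∈ Φ then χ (Additive.ofMul (s : G)) else 0) =
      χ (Additive.ofMul (s : G)) - if s ∈ f then χ (Additive.ofMul (s : G)) else 0 := by
    intro s
    by_cases hs : s ∈ f
    · rw [if_pos hs, if_neg ((hf s).1 hs), sub_self]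
    · rw [if_neg hs, if_pos (not_not.1 fun h' => hs ((hf s).2 h')), sub_zero]
  simp_rw [h2, h3]
  rw [Finset.sum_sub_distrib, Finset.sum_ite_mem, Finset.sum_ite_mem, Finset.univ_inter,
    Finset.sum_neg_distrib]
  ring

/-- The number of odd characters of `G` vanishing on `Φ = Φᶠ` is the number of characters `ψ` of `G₀` with
`Σ_{s∈G₀} ψ(s) − 2Σ_{s∈f} ψ(s) = 0`: restriction to `G₀` is a bijection from the odd characters of `G` onto the
characters of `G₀` (an odd character is determined by its restriction, `χ(ρs) = −χ(s)`, and both sets have `|G₀|`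
elements). [cite: Kubota1965, §4 Lemma 2 (proof)] [cite: Dodson1984, §3.1.1 Theorem] -/
private theorem ncard_oddChar_vanishing_eq [Fintype ↥G₀] (h : IsCMTypeWith ρ (Φ : Set G)) (hρ : ρ ∉ G₀)
    (hG : ∀ g : G, g ∈ G₀ ∨ ρ * g ∈ G₀) (f : Finset ↥G₀) (hf : ∀ s : ↥G₀, s ∈ f ↔ (s : G) ∉ Φ) :
    {χ : AddChar (Additive G) ℂ | χ (Additive.ofMul ρ) = -1 ∧ ∑ s ∈ Φ, χ (Additive.ofMul s) = 0}.ncard =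
      {ψ : AddChar (Additive ↥G₀) ℂ |
        ∑ s : ↥G₀, ψ (Additive.ofMul s) - 2 * ∑ s ∈ f, ψ (Additive.ofMul s) = 0}.ncard := by
  classical
  have hρ2 : ρ * ρ = 1 := by
    have := h.invol (1 : G)
    simpa [smul_eq_mul] using this
  -- restriction of characters to `G₀`
  let res : AddChar (Additive G) ℂ → AddChar (Additive ↥G₀) ℂ := fun χ =>
    χ.compAddMonoidHom (MonoidHom.toAdditive G₀.subtype)
  have res_apply : ∀ (χ : AddChar (Additive G) ℂ) (s : ↥G₀),
      res χ (Additive.ofMul s) = χ (Additive.ofMul (s : G)) := fun _ _ => rfl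
  set Odd : Set (AddChar (Additive G) ℂ) := {χ | χ (Additive.ofMul ρ) = -1} with hOdd_def
  -- an odd character is determined by its restriction
  have hinj : Set.InjOn res Odd := by
    intro χ₁ h₁ χ₂ h₂ he
    have hG₀ : ∀ s : ↥G₀, χ₁ (Additive.ofMul (s : G)) = χ₂ (Additive.ofMul (s : G)) := fun s => by
      rw [← res_apply χ₁, ← res_apply χ₂, he]
    have e1 : ∀ χ : AddChar (Additive G) ℂ, χ (Additive.ofMul ρ) = -1 → ∀ g : G,
        χ (Additive.ofMul g) = -χ (Additive.ofMul (ρ * g)) := by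
      intro χ hχ g
      rw [ofMul_mul, map_add_eq_mul, hχ]; ring
    ext a
    obtain ⟨g, rfl⟩ : ∃ g : G, Additive.ofMul g = a := ⟨Additive.toMul a, rfl⟩
    rcases hG g with hg | hg
    · exact hG₀ ⟨g, hg⟩
    · rw [e1 χ₁ h₁, e1 χ₂ h₂, hG₀ ⟨ρ * g, hg⟩]
  -- and every character of `G₀` is the restriction of an odd character (counting)
  have hsurj : res '' Odd = Set.univ := by
    refine Set.eq_of_subset_of_ncard_le (Set.subset_univ _) ?_ Set.finite_univ
    rw [Set.ncard_univ, hinj.ncard_image, hOdd_def, ncard_oddChar_eq_card G₀ hρ hG hρ2,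
      Nat.card_eq_fintype_card, AddChar.card_eq, Fintype.card_congr Additive.toMul]
  have hset : res '' {χ | χ (Additive.ofMul ρ) = -1 ∧ ∑ s ∈ Φ, χ (Additive.ofMul s) = 0} =
      {ψ : AddChar (Additive ↥G₀) ℂ |
        ∑ s : ↥G₀, ψ (Additive.ofMul s) - 2 * ∑ s ∈ f, ψ (Additive.ofMul s) = 0} := by
    ext ψ
    simp only [Set.mem_image, Set.mem_setOf_eq]
    constructor
    · rintro ⟨χ, ⟨hχ, h0⟩, rfl⟩
      simp only [res_apply]
      rw [← sum_oddChar_eq_sub G₀ h hρ hG f hf χ hχ, h0]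
    · intro hψ
      obtain ⟨χ, hχ, rfl⟩ : ψ ∈ res '' Odd := by rw [hsurj]; exact Set.mem_univ _
      refine ⟨χ, ⟨hχ, ?_⟩, rfl⟩
      rw [sum_oddChar_eq_sub G₀ h hρ hG f hf χ hχ]
      simpa only [res_apply] using hψ
  rw [← hset, (hinj.mono fun χ hχ => hχ.1).ncard_image]

/-- **Dodson's constant weight criterion, for an abelian CM field (exact form).**  Let `Φ` be a
CM type of `G = G₀ ⊔ ρG₀` (`G` finite commutative acting on itself, `ρ ∉ G₀`), `f = {s ∈ G₀ : s ∉ Φ}` its weight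
vector, `r = typeRank G₀ f` the rank of the span of the `G₀`-translates of `f`, `n = |G₀|`.  Then
`t(Φ) + [2|f| = n] = r + 1 + [|f| = 0]`.
"Let `Φ = Φᶠ`, `f ∈ (ℤ₂)ⁿ`, be a CM-type on `K` and let `r` be the rank of the `ℤ`-span of the orbit `G₀*(f)` […].
Then `t(Φ) = r + 1`, unless the weight of `f` is `n/2`, in which case `t(Φ) = r` may also occur."
[cite: Dodson1984, §3.1.1 Theorem (constant weight criterion)] -/
theorem typeRank_add_eq_typeRank_weight_add (h : IsCMTypeWith ρ (Φ : Set G)) (hρ : ρ ∉ G₀)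
    (hG : ∀ g : G, g ∈ G₀ ∨ ρ * g ∈ G₀) (f : Finset ↥G₀) (hf : ∀ s : ↥G₀, s ∈ f ↔ (s : G) ∉ Φ) :
    typeRank G (Φ : Set G) + (if 2 * f.card = Nat.card ↥G₀ then 1 else 0) =
      typeRank ↥G₀ (f : Set ↥G₀) + 1 + (if f.card = 0 then 1 else 0) := by
  classical
  haveI : Fintype ↥G₀ := Fintype.ofFinite _
  have hρ2 : ρ * ρ = 1 := by
    have := h.invol (1 : G)
    simpa [smul_eq_mul] using this
  rw [Nat.card_eq_fintype_card]
  -- Kubota: `t + #{odd χ vanishing on Φ} = #{odd χ} + 1 = |G₀| + 1`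
  have hK := h.typeRank_add_ncard_oddCharacters_vanishing
  rw [ncard_oddChar_eq_card G₀ hρ hG hρ2, ncard_oddChar_vanishing_eq G₀ h hρ hG f hf] at hK
  -- analysis of the characters `ψ` of `G₀`
  have hr := typeRank_eq_ncard_sum_ne_zero f
  have hcardΨ : Nat.card (AddChar (Additive ↥G₀) ℂ) = Fintype.card ↥G₀ := by
    rw [Nat.card_eq_fintype_card, AddChar.card_eq, Fintype.card_congr Additive.toMul]
  have hpos : 0 < Fintype.card ↥G₀ := Fintype.card_pos
  have hne : ∀ ψ : AddChar (Additive ↥G₀) ℂ, ψ ≠ 0 → ∑ s : ↥G₀, ψ (Additive.ofMul s) = 0 := by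
    intro ψ hψ
    rw [← (AddChar.sum_eq_zero_iff_ne_zero (ψ := ψ)).2 hψ]
    exact Fintype.sum_equiv Additive.ofMul _ _ fun x => rfl
  set Z : Set (AddChar (Additive ↥G₀) ℂ) := {ψ | ψ ≠ 0 ∧ ∑ s ∈ f, ψ (Additive.ofMul s) = 0} with hZ
  set N : Set (AddChar (Additive ↥G₀) ℂ) := {ψ | ψ ≠ 0 ∧ ∑ s ∈ f, ψ (Additive.ofMul s) ≠ 0} with hN
  -- (i) `#Z + #N = |G₀| − 1`
  have hi : Z.ncard + N.ncard = Fintype.card ↥G₀ - 1 := by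
    have hsplit := Set.ncard_inter_add_ncard_sdiff_eq_ncard {ψ : AddChar (Additive ↥G₀) ℂ | ψ ≠ 0}
      {ψ : AddChar (Additive ↥G₀) ℂ | ∑ s ∈ f, ψ (Additive.ofMul s) = 0} (Set.toFinite _)
    have h1 : {ψ : AddChar (Additive ↥G₀) ℂ | ψ ≠ 0} ∩
        {ψ : AddChar (Additive ↥G₀) ℂ | ∑ s ∈ f, ψ (Additive.ofMul s) = 0} = Z := by
      ext ψ; simp only [Set.mem_inter_iff, Set.mem_setOf_eq, hZ]
    have h2 : {ψ : AddChar (Additive ↥G₀) ℂ | ψ ≠ 0} \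
        {ψ : AddChar (Additive ↥G₀) ℂ | ∑ s ∈ f, ψ (Additive.ofMul s) = 0} = N := by
      ext ψ; simp only [Set.mem_sdiff, Set.mem_setOf_eq, hN]
    have h3 : {ψ : AddChar (Additive ↥G₀) ℂ | ψ ≠ 0}.ncard = Fintype.card ↥G₀ - 1 := by
      have : {ψ : AddChar (Additive ↥G₀) ℂ | ψ ≠ 0} = Set.univ \ {0} := by
        ext ψ; simp only [Set.mem_setOf_eq, Set.mem_sdiff, Set.mem_univ, Set.mem_singleton_iff, true_and]
      rw [this, Set.ncard_sdiff_singleton_of_mem (Set.mem_univ _), Set.ncard_univ, hcardΨ]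
    rw [h1, h2, h3] at hsplit
    exact hsplit
  -- (ii) the vanishing count on `G₀`: `ψ = 0` contributes iff `2|f| = |G₀|`, `ψ ≠ 0` iff `Σ_f ψ = 0`
  have hA : ∀ ψ : AddChar (Additive ↥G₀) ℂ,
      ∑ s : ↥G₀, ψ (Additive.ofMul s) - 2 * ∑ s ∈ f, ψ (Additive.ofMul s) = 0 ↔
        (ψ = 0 ∧ 2 * f.card = Fintype.card ↥G₀) ∨ (ψ ≠ 0 ∧ ∑ s ∈ f, ψ (Additive.ofMul s) = 0) := by
    intro ψ
    by_cases hψ : ψ = 0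
    · subst hψ
      simp only [AddChar.zero_apply, Finset.sum_const, Finset.card_univ, nsmul_eq_mul, mul_one, true_and,
        ne_eq, not_true_eq_false, false_and, or_false]
      rw [sub_eq_zero]
      constructor
      · intro h'; exact_mod_cast h'.symm
      · intro h'; exact_mod_cast h'.symm
    · simp only [hψ, false_and, false_or, ne_eq, not_false_eq_true, true_and]
      rw [hne ψ hψ, zero_sub, neg_eq_zero, mul_eq_zero, or_iff_right (two_ne_zero' ℂ)]
  have hii : {ψ : AddChar (Additive ↥G₀) ℂ |
      ∑ s : ↥G₀, ψ (Additive.ofMul s) - 2 * ∑ s ∈ f, ψ (Additive.ofMul s) = 0}.ncard =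
      (if 2 * f.card = Fintype.card ↥G₀ then 1 else 0) + Z.ncard := by
    by_cases hc : 2 * f.card = Fintype.card ↥G₀
    · rw [if_pos hc]
      have : {ψ : AddChar (Additive ↥G₀) ℂ |
          ∑ s : ↥G₀, ψ (Additive.ofMul s) - 2 * ∑ s ∈ f, ψ (Additive.ofMul s) = 0} = insert 0 Z := by
        ext ψ
        simp only [Set.mem_setOf_eq, Set.mem_insert_iff, hA, hc, and_true, hZ]
      rw [this, Set.ncard_insert_of_notMem (fun h' => h'.1 rfl) (Set.toFinite _), add_comm]
    · rw [if_neg hc, zero_add]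
      congr 1
      ext ψ
      simp only [Set.mem_setOf_eq, hA, hc, and_false, false_or, hZ]
  -- (iii) the rank count on `G₀`: `ψ = 0` contributes iff `f ≠ ∅`
  have hB0 : ∑ s ∈ f, (0 : AddChar (Additive ↥G₀) ℂ) (Additive.ofMul s) = (f.card : ℂ) := by
    simp only [AddChar.zero_apply, Finset.sum_const, nsmul_eq_mul, mul_one]
  have hiii : {ψ : AddChar (Additive ↥G₀) ℂ | ∑ s ∈ f, ψ (Additive.ofMul s) ≠ 0}.ncard +
      (if f.card = 0 then 1 else 0) = 1 + N.ncard := by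
    by_cases hc : f.card = 0
    · rw [if_pos hc]
      have : {ψ : AddChar (Additive ↥G₀) ℂ | ∑ s ∈ f, ψ (Additive.ofMul s) ≠ 0} = N := by
        ext ψ
        simp only [Set.mem_setOf_eq, hN]
        constructor
        · intro h'
          refine ⟨?_, h'⟩
          rintro rfl
          rw [hB0, hc, Nat.cast_zero] at h'
          exact h' rfl
        · exact fun h' => h'.2
      rw [this, add_comm]
    · rw [if_neg hc, add_zero]
      have : {ψ : AddChar (Additive ↥G₀) ℂ | ∑ s ∈ f, ψ (Additive.ofMul s) ≠ 0} = insert 0 N := by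
        ext ψ
        simp only [Set.mem_setOf_eq, Set.mem_insert_iff, hN]
        constructor
        · intro h'
          by_cases hψ : ψ = 0
          · exact Or.inl hψ
          · exact Or.inr ⟨hψ, h'⟩
        · rintro (rfl | ⟨-, h'⟩)
          · rw [hB0]; exact_mod_cast hc
          · exact h'
      rw [this, Set.ncard_insert_of_notMem (fun h' => h'.1 rfl) (Set.toFinite _), add_comm]
  rw [hr]
  omega

/-- **Constant weight criterion, generic weight: `t(Φ) = r + 1`** when the weight `|f|` is neither `0` nor `n/2`.
[cite: Dodson1984, §3.1.1 Theorem ("Then `t(Φ) = r + 1`, unless the weight of `f` is `n/2`")] -/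
theorem typeRank_eq_typeRank_weight_add_one (h : IsCMTypeWith ρ (Φ : Set G)) (hρ : ρ ∉ G₀)
    (hG : ∀ g : G, g ∈ G₀ ∨ ρ * g ∈ G₀) (f : Finset ↥G₀) (hf : ∀ s : ↥G₀, s ∈ f ↔ (s : G) ∉ Φ)
    (h0 : f.card ≠ 0) (h2 : 2 * f.card ≠ Nat.card ↥G₀) :
    typeRank G (Φ : Set G) = typeRank ↥G₀ (f : Set ↥G₀) + 1 := by
  have := typeRank_add_eq_typeRank_weight_add G₀ h hρ hG f hf
  rw [if_neg h2, if_neg h0] at this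
  omega

/-- **Constant weight criterion, weight `n/2`: `t(Φ) = r`** — for an abelian CM field Dodson's "in which case
`t(Φ) = r` may also occur" is forced. [cite: Dodson1984, §3.1.1 Theorem] -/
theorem typeRank_eq_typeRank_weight (h : IsCMTypeWith ρ (Φ : Set G)) (hρ : ρ ∉ G₀)
    (hG : ∀ g : G, g ∈ G₀ ∨ ρ * g ∈ G₀) (f : Finset ↥G₀) (hf : ∀ s : ↥G₀, s ∈ f ↔ (s : G) ∉ Φ)
    (h2 : 2 * f.card = Nat.card ↥G₀) :
    typeRank G (Φ : Set G) = typeRank ↥G₀ (f : Set ↥G₀) := by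
  have := typeRank_add_eq_typeRank_weight_add G₀ h hρ hG f hf
  have h0 : f.card ≠ 0 := by
    intro h0
    rw [h0, mul_zero] at h2
    exact (Nat.card_pos (α := ↥G₀)).ne' h2.symm
  rw [if_pos h2, if_neg h0] at this
  omega

/-- **Weight `0`: the type `Φ ⊇ G₀` induced from the imaginary quadratic subfield has `t(Φ) = 2`** (and `r = 0`; the
case tacitly outside Dodson's formula `t = r + 1`). [cite: Dodson1984, §3.1.1 Theorem; §3.1.0 ("rank(K, Φ) =
rank(K', Φ')")] -/
theorem typeRank_eq_two_of_weight_zero (h : IsCMTypeWith ρ (Φ : Set G)) (hρ : ρ ∉ G₀)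
    (hG : ∀ g : G, g ∈ G₀ ∨ ρ * g ∈ G₀) (f : Finset ↥G₀) (hf : ∀ s : ↥G₀, s ∈ f ↔ (s : G) ∉ Φ)
    (h0 : f.card = 0) : typeRank G (Φ : Set G) = 2 := by
  have := typeRank_add_eq_typeRank_weight_add G₀ h hρ hG f hf
  have hf0 : f = ∅ := Finset.card_eq_zero.1 h0
  have hr : typeRank ↥G₀ (f : Set ↥G₀) = 0 := by
    rw [typeRank_eq_ncard_sum_ne_zero f, hf0]
    simp
  have h2 : 2 * f.card ≠ Nat.card ↥G₀ := by
    rw [h0, mul_zero]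
    exact (Nat.card_pos (α := ↥G₀)).ne
  rw [if_neg h2, if_pos h0, hr] at this
  omega

end ConstantWeight

end Dodson1984

end Literature.NumberTheory.ComplexMultiplication

end
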